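import Summits.BirchSwinnertonDyer.BirchSwinnertonDyer.Theorems.KimAtThreeStubPairCountAtEmpty
import Summits.BirchSwinnertonDyer.BirchSwinnertonDyer.Theorems.KimAtThreeStubPinnedOfParts
import HarnessLib

/-!
# The 19561 stub on pinned data from the route's two published inputs ALONE:
# `SakamotoKolyvaginThree → PoitouTateSelmerDuality → (stub at ∅ for every pinned canonical τ-datum)`
# (item stmt-BirchSwinnertonDyer-19561 `KimAtThreeKolyvagin.StubAtEmptyLevelThree`; seat
# bsd-addord-w2-c5 gen 4)

w2-c5 gen 3's `KimAtThreeStubOfLiftable.stubAtEmptyLevelThree_pinned_of_parts` carries, besides the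
sibling items `SakamotoKolyvaginThree` (19558) and `PoitouTateSelmerDuality` (19559), two further
displayed antecedents: Tate's local Euler–Poincaré characteristic `hEP` and the Poitou–Tate PAIR
COUNTS at `∅` at every depth.  Both are theorems of the tree now (`hEP`: n1011-p04
`EP.forall_localEulerPoincareCharacteristic_adicCompletion`; the counts: the sibling
`KimAtThreeStubPairCountAtEmpty.natCard_selmerGroup_propagated_three_eq`, port-free, via the local
index of p502450), whence
**`stubAtEmptyLevelThree_pinned_of_pub : SakamotoKolyvaginThree → PoitouTateSelmerDuality → …`** —
the 19561 conclusion `g ∅ = 3^{n₀} • e + m` for every depth `k`, every `τ` deep to `3^{2k+2}`, every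
admissible `S` and every PINNED canonical `τ`-datum, from the route's two cite-only leaves BY NAME
and nothing else.  What this is NOT: a proof of the item AS FILED (`StubAtEmptyLevelThree` has no
antecedent at all and quantifies over sub-data `𝒫 ⊆ class` with a shallow `τ`); see the seat memo.
References: [MazurRubin2004] Prop. 2.3.5, Thm. 4.4.1; [MilneADT2006] I Thm. 2.8, 4.10;
[Sakamoto2024] Thm. 4.4.
-/

set_option autoImplicit false
-- the Theorems namespace of a single-conjunct summit repeats the summit name by design (D-0017)
set_option linter.dupNamespace false

noncomputable section

open scoped Classical NumberField ContRepresentation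
open Function Field NumberField IsDedekindDomain WeierstrassCurve Literature.NumberTheory.EllipticCurves
  Literature.NumberTheory.GaloisRepresentations Literature.NumberTheory.GaloisRepresentations.DiscreteGaloisModule
  Literature.NumberTheory.GaloisCohomology Literature.NumberTheory.GaloisCohomology.KolyvaginDatum
  Summit.BirchSwinnertonDyer.Rank1Residual.GaloisImage

namespace Summit.BirchSwinnertonDyer.BirchSwinnertonDyer.Theorems.KimAtThreeStubLocalIndex

open Summit.BirchSwinnertonDyer.BirchSwinnertonDyer.Theses.KimAtThreeKolyvagin

/-! ### §2. The 19561 stub for pinned data from the two published inputs alone -/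

/-- **The 19561 stub on PINNED data ⟸ `SakamotoKolyvaginThree ∧ PoitouTateSelmerDuality` (the
route's sibling items 19558, 19559 BY NAME) and nothing else.**  For every elliptic `W/ℚ` with the
`3`-adic tower onto, every generator family `η`, every depth `k`, every `τ ∈ Γ_ℚ` fixing
`μ_{3^{2k+2}}` with `E[3^{2k+2}]/(τ − 1) ≃ ℤ/3^{2k+2}` (deep enough for the levels `k, 2k, 2k+1`),
every finite `S ⊇ {∞, 3, bad}`, and every PINNED canonical `τ`-datum `Dk` for `E[3^{k+1}]`
(`primes = class`, cyclotomic transverse conditions, canonical comparison for `η`), with `g` an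
`ℕ`-generator of `KS(Dk, 𝓕_can)` and `#H¹_{𝓕_can}(ℚ, E[3^{k+1}]) = 3^{k+1}·3^{n₀}`:
`g ∅ = 3^{n₀} • e + m`, `e ∈ H¹_{𝓕_can}`, `m ∈ H¹_𝓚` — gen 3's `stubAtEmptyLevelThree_pinned_of_parts`
with `hEP` (Tate, a theorem) and the pair counts at `∅` (`natCard_selmerGroup_propagated_three_eq`)
DISCHARGED.  Mazur–Rubin Thm. 4.4.1 / Cor. 4.5.2 at `p = 3` over Sakamoto's Thm. 4.4.
[cite: MazurRubin2004, Thm. 4.4.1 and Prop. 2.3.5] [cite: Sakamoto2024, Thm. 4.4 (p. 926)] -/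
theorem stubAtEmptyLevelThree_pinned_of_pub
    (hSak : SakamotoKolyvaginThree) (hPT : PoitouTateSelmerDuality) :
    ∀ (W : WeierstrassCurve ℚ) [W.IsElliptic],
      (∀ n : ℕ, W.HasSurjectiveModNGaloisRep (3 ^ n : ℕ)) →
      ∀ (η : (q : HeightOneSpectrum (𝓞 ℚ)) → (ZMod (Ideal.absNorm q.asIdeal))ˣ),
        (∀ q, Subgroup.zpowers (η q) = ⊤) →
      ∀ (k : ℕ) (τ : absoluteGaloisGroup ℚ), τ ∈ rootsOfUnityFixer ℚ (3 ^ (k + k + 1 + 1)) →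
        Nonempty (cokerSubOne (W.torsionGaloisModule (((3 : ℕ) : ℤ) ^ (k + k + 1) * ((3 : ℕ) : ℤ))) τ ≃+
          ZMod (3 ^ (k + k + 1 + 1))) →
      ∀ (S : Finset (Place ℚ)), (∀ w : InfinitePlace ℚ, (Sum.inl w : Place ℚ) ∈ S) →
        (∀ v : HeightOneSpectrum (𝓞 ℚ), ((3 : ℕ) : 𝓞 ℚ) ∈ v.asIdeal → (Sum.inr v : Place ℚ) ∈ S) →
        (∀ v : HeightOneSpectrum (𝓞 ℚ), ¬ W.HasGoodReductionAt v → (Sum.inr v : Place ℚ) ∈ S) →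
      ∀ (Dk : KolyvaginDatum (W.torsionGaloisModule (((3 : ℕ) : ℤ) ^ k * ((3 : ℕ) : ℤ))))
        (g : Finset (HeightOneSpectrum (𝓞 ℚ)) →
          galoisCohomology (W.torsionGaloisModule (((3 : ℕ) : ℤ) ^ k * ((3 : ℕ) : ℤ))) 1) (n₀ : ℕ),
        Dk.primes = frobeniusClassPrimes (W.torsionGaloisModule (((3 : ℕ) : ℤ) ^ k * ((3 : ℕ) : ℤ)))
          {v | (Sum.inr v : Place ℚ) ∈ S} τ (3 ^ (k + 1)) →
        Dk.transverse = cyclotomicTransverse _ → Dk.HasCanonicalComparison (3 ^ (k + 1)) η →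
        g ∈ Dk.kolyvaginSystems (propagatedSelmerStructure W 3 k) →
        (∀ κ ∈ Dk.kolyvaginSystems (propagatedSelmerStructure W 3 k), ∃ a : ℕ, κ = a • g) →
        Nat.card (propagatedSelmerStructure W 3 k).selmerGroup = 3 ^ (k + 1) * 3 ^ n₀ →
        ∃ e ∈ (propagatedSelmerStructure W 3 k).selmerGroup,
          ∃ m ∈ (W.kummerSelmerStructure (((3 : ℕ) : ℤ) ^ k * ((3 : ℕ) : ℤ))).selmerGroup,
            g ∅ = 3 ^ n₀ • e + m :=
  KimAtThreeStubOfLiftable.stubAtEmptyLevelThree_pinned_of_parts hSak hPT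
    (EP.forall_localEulerPoincareCharacteristic_adicCompletion ℚ)
    (fun W _ i _ inv _ hperf hsum _ hcompl =>
      natCard_selmerGroup_propagated_three_eq W i inv hperf hsum hcompl)

end Summit.BirchSwinnertonDyer.BirchSwinnertonDyer.Theorems.KimAtThreeStubLocalIndex

end
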